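import Summits.QuantumFields.YangMills.Theorems.BalabanUVNodesN22NestedPolymersTerms

/-!
# THE NESTED-POLYMERS TOWER — ★★★ THE (1.21)-EXISTENCE SCHEMA FIRES AT def-W1's `localizedSum` OF A GENUINE `ClusterTower`, NON-DEGENERATELY (A6 lane, dag-n22-w3)

Cell `pub-ymgap`, Track A (HUMAN RULING D-0062), WIDTH SEAT `dag-n22-w3` g5 on node n22 = NE9, A6-residue lane; `--kind proof --supports stmt-QuantumFields-27366 --as helper` (KEY MAP v2:
K3⁸), COUNT-NEUTRAL; THEOREMS ONLY (0 `def`, 0 `sorry`, standard axioms).  Sequel of `…N22NestedPolymersDefs ∕ KP ∕ Terms` (this seat).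

WHY.  [I] p. 264: «Now we take a limit of these functions as T^{(j+1)} ↗ Z^d.  This limit exists by the localized representation (1.7)» — the terms of domains not feeling the volume are
the same on every larger torus, the volume-feeling ones are exponentially few.  This lineage typed the sentence as the hard schema p597055 `polLimitExists_sum_of_stable_tail` ((C²) +
exact (S) + geometric (T) ⇒ Cauchy ⇒ def-B's `PolLimitExists`) with the instance `polLimitsExist_localizedSum_of_stable_tail` at def-W1's ACTUAL objects (`Node00.localizedSum` of a family
of `W1.ClusterTower`s, (2.13) = `B13Resummation.locE` on def-T's `Sect2.domSys`); every inhabitant in the tree at THOSE objects is degenerate (termless tower ∕ zero chart: `…_fires_zeroTower`,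
`polLimitExists_zeroChart`, dag-n18-w2 g9's `…_truncationStable_fires_zeroChart`) — this seat's g4 ■ recorded the non-degenerate witness there as «not w-sized».  THIS FILE lands it:
on the `K`-th torus the tower `nestedTower F M a` has `K + 1` NESTED straight polymers through the window origin (pairwise touching ⇒ pairwise incompatible in (2.11)), activities
`a k i g · 𝐔(b₀)`; by [KP86] (2)–(3) their (2.13) terms are the successive differences of `Log(1 + 𝐔(b₀)·Σ_{i ≤ j} a k i g)` (`…Terms`), the terms of every other domain vanish, so along
def-B's chart read by `originReading F` the `K + 1` term charts of the `K`-th torus are `log(1 + e^t Σ_{i≤j} a) − log(1 + e^t Σ_{i<j} a)` (`t = B(e₀, window origin)`) — VOLUME-BLIND: the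
SAME functions on the `(K+1)`-th torus ((S) EXACT), where ONE new polymer appears whose kernel is `ψ(Σ_{i ≤ K+1} a) − ψ(Σ_{i ≤ K} a)`, `|·| ≤ a k (K+1) g ≤ C r^K` ((T)), `ψ(A) = A∕(1+A)²`.

* §1 `expChart_term_segDom` ∕ `expChart_term_other` (the term charts, at EVERY volume thanks to the cap), `contDiff_log_one_add_mul_exp_bondEval`, `contDiffAt_expChart_term` ((C²) of the
  schema at the tower), `sum_univ_expChart_term` ∕ `sum_univ_ne_top_expChart_term` (the term charts telescope: `Finset.sum_range_sub`), `sum_polScalar_term_eq` (additivity of def-B's kernel,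
  J27 `polScalar_finset_sum`, + `polScalar_onSiteFun`).
* §2 ★★★ `polLimitsExist_localizedSum_nestedTower` — W1-19b's `PolLimitsExist F (localizedSum F (nestedTower F M a) (originReading F)) id 𝟙 W` on every window, BY p597055's schema, for
  amplitudes `a ≥ 0` with `a k (i+1) g ≤ C r^i`, `0 ≤ r < 1`.
* §3 NON-DEGENERACY: ★ `polWindow_localizedSum_nestedTower` (the window kernel of the localized sum in closed form `[br] · ψ(Σ_{i ≤ cap} a k i hist)`), ★★
  `polWindow_localizedSum_nestedTower_lt_succ` ∕ `not_eventuallyConst_polWindow_localizedSum_nestedTower` (for `a > 0` of total mass `≤ 1` the kernels STRICTLY INCREASE with the volume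
  from the threshold on — the (1.21) limit is attained at NO finite volume; dag-n22-w3 g2's `polLimitExists_of_eventually_const` does not apply), ★ `E_nestedTower_one_pos` (THE TOWER IS
  GENUINE: `K + 1` distinct domains of the `K`-th torus carry non-zero (2.13) terms at the unit configuration, read through the reading map), `geometricAmplitudes_admissible` (all
  hypotheses jointly met by `a k i g := (1 − q) q^i ∕ 2`, `0 < q < 1`).

HONEST FRAMING (binding).  A MODEL-LEVEL A6 witness (test activities on def-T's catalogue, scalar probe algebra `𝔄 = ℝ`, `ρ = id`, one colour; the activities read the probe
configuration at ONE bond, with real amplitudes that may read the young couplings): NOT Bałaban's activities (2.9)–(2.11), NOT the towers OF RECORD, NOT a reading OF RECORD; inhabits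
NO letter OF RECORD; nothing of Bałaban's asserted or constructed; (1.21)'s existence for the terms OF RECORD is NOT proved; N22 NOT discharged; K3⁸ `SpineGivenEndpointR13SepCoPHV` OPEN,
not claimed, no stub touched; counts UNMOVED (typed 28∕28 · discharged 5∕27; the chair's single count line is the only count); one finite 𝕋⁴ programme at fixed ε — R4 closes the
CONDITIONAL rung `BalabanLadder.UV` only; NOTHING about the continuum limit, ℝ⁴, OS axioms or a mass gap is proved or claimed; the Yang–Mills mass gap (Clay) is NOT proved by any of
this.  No cite tags (Summit side); TYPES only: [I] = [Balaban1987RG1] CMP **109** (1987) (1.7) p. 261, (1.20)–(1.21) p. 264; [II] = [Balaban1988RG2Cluster] CMP **116** (1988)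
(2.9)–(2.14) pp. 14–15; [KP86] = Kotecký–Preiss, CMP **103** (1986) (2)–(3).
-/

noncomputable section

open Finset Filter Topology
open scoped BigOperators

namespace YMDAG.N22.AtKernels.NestedPolymers

open Literature.Probability.LatticeModels
open Literature.MathematicalPhysics.QuantumFieldTheory.Balaban1983to89
open Literature.MathematicalPhysics.QuantumFieldTheory.Balaban1983to89.T4ActivityRecursionWitness (one_add_mul_mem_slitPlane isCompatible_singleton)
open Literature.MathematicalPhysics.QuantumFieldTheory.Balaban1983to89.B13Resummation (locE)
open Literature.MathematicalPhysics.QuantumFieldTheory.Balaban1983to89.B13FamilySum (coveringFamilies mem_coveringFamilies)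
open Literature.MathematicalPhysics.QuantumFieldTheory.Balaban1983to89.TreeLengthTorus (TPt TAdj TStepIn TLinked TFaceConnected IsTDom TDom tsys
  tadj_update_add_one)
open Literature.MathematicalPhysics.QuantumFieldTheory.Balaban1983to89.TreeLengthTorusGeometry (TTouch ttouch_symm tgeometry)
open Literature.MathematicalPhysics.QuantumFieldTheory.Balaban1983to89.T4Continuum (T4Family)
open Literature.MathematicalPhysics.QuantumFieldTheory.Balaban1983to89.Node00 (siteOfInt polScalar polWindow polLimit PolLimitExists TermFamily1)
open Literature.MathematicalPhysics.QuantumFieldTheory.Balaban1983to89.Node00.Sect2 (domSys domCount CPair)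
open Literature.MathematicalPhysics.QuantumFieldTheory.Balaban1983to89.B14.Eq213MaximalDomains (side)
open Literature.MathematicalPhysics.QuantumFieldTheory.Balaban1983to89.Node00.W1 (ClusterStep ClusterTower)
open Literature.MathematicalPhysics.QuantumFieldTheory.Balaban1983to89.Node00.LocalizedSum17 (localizedSum ReadingMaps)
open Literature.MathematicalPhysics.QuantumFieldTheory.Balaban1983to89.Node00.U3KernelLetters (PolLimitsExist)
open Literature.MathematicalPhysics.QuantumFieldTheory.Balaban1983to89.Node00.U3OfKernels (histPrefix)
open YMDAG.N18.FiniteVolumeLettersModel (bondEval bondEval_apply siteOfInt_eventually_ne)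
open YMDAG.N22.AtKernels.NestedTermsModel (exists_threshold_siteOfInt)
open Literature.MathematicalPhysics.QuantumFieldTheory.Balaban1983to89.B12PolarizationTensor120 (polTensor polComp expChart)

/-! ## §1 Term charts, (C²), telescoping -/

section Charts

variable (F : T4Family) (M : ℕ)

/-- **THE CHART OF THE (2.13) TERM OF A NESTED POLYMER, READ AT THE ORIGIN** (`a ≥ 0`, `j ≤ min K (n−1)`): along the exponential chart `U = e^{B}` the term is the real number
`log(1 + e^{B(e₀, 0)}·Σ_{i ≤ j} a i) − log(1 + e^{B(e₀, 0)}·Σ_{i < j} a i)`. -/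
theorem expChart_term_segDom {a : (k : ℕ) → ℕ → (Fin (k + 1) → ℝ) → ℝ} (ha : ∀ k i g, 0 ≤ a k i g) (K k : ℕ) (hist : Fin (k + 1) → ℝ) {j : ℕ}
    (hj : j ≤ min K (domCount (F.P K) M (k + 1) - 1)) :
    expChart (F := ℝ) (fun U : Fin (F.P K).d → Site (F.P K) (k + 1) → ℝ =>
        (((nestedTower F M a K) k).E hist (originReading F K k U) (segDom (domCount (F.P K) M (k + 1)) (Fin.cast (F.P_d K).symm 0) j)).re)
      (ContinuousLinearMap.id ℝ ℝ) =
      fun B => Real.log (1 + (∑ i ∈ Finset.range (j + 1), a k i hist) * Real.exp (bondEval (Fin.cast (F.P_d K).symm 0) (siteOfInt F K (k + 1) 0) B)) -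
        Real.log (1 + (∑ i ∈ Finset.range j, a k i hist) * Real.exp (bondEval (Fin.cast (F.P_d K).symm 0) (siteOfInt F K (k + 1) 0) B)) := by
  funext B
  rw [B12PolarizationTensor120.expChart_apply]
  have hφ : (originReading F K k (fun ν y => NormedSpace.exp ((ContinuousLinearMap.id ℝ ℝ) (B ν y)))).1 ⟨default, Fin.cast (F.P_d K).symm 0⟩ =
      ((Real.exp (bondEval (Fin.cast (F.P_d K).symm 0) (siteOfInt F K (k + 1) 0) B) : ℝ) : ℂ) := by
    rw [originReading_fst, Real.exp_eq_exp_ℝ]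
    rfl
  unfold nestedTower
  rw [E_nestedStep_segDom_ofReal (Fin.cast (F.P_d K).symm 0) (cap_spec K _) hist (ha k · hist) (Real.exp_pos _) hφ hj, Complex.ofReal_re]
  ring_nf

/-- **THE OTHER TERMS VANISH ALONG THE CHART.** -/
theorem expChart_term_other (a : (k : ℕ) → ℕ → (Fin (k + 1) → ℝ) → ℝ) (K k : ℕ) (hist : Fin (k + 1) → ℝ) {X : (domSys (F.P K) M (k + 1)).Dom}
    (hX : ∀ i ≤ min K (domCount (F.P K) M (k + 1) - 1), X ≠ segDom (domCount (F.P K) M (k + 1)) (Fin.cast (F.P_d K).symm 0) i) :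
    expChart (F := ℝ) (fun U : Fin (F.P K).d → Site (F.P K) (k + 1) → ℝ => (((nestedTower F M a K) k).E hist (originReading F K k U) X).re)
      (ContinuousLinearMap.id ℝ ℝ) = fun _ => 0 := by
  funext B
  rw [B12PolarizationTensor120.expChart_apply]
  unfold nestedTower
  rw [E_nestedStep_eq_zero (Fin.cast (F.P_d K).symm 0) (a k) (cap_spec K _) hist _ hX, Complex.zero_re]

/-- The chart of the logarithmic on-site functional is smooth. -/
theorem contDiff_log_one_add_mul_exp_bondEval {A : ℝ} (hA : 0 ≤ A) {Λ T : Type*} [Fintype Λ] [Fintype T] (μ₀ : Λ) (x₀ : T) {n : WithTop ℕ∞} :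
    ContDiff ℝ n fun B : Λ → T → ℝ => Real.log (1 + A * Real.exp (bondEval μ₀ x₀ B)) := by
  refine ContDiff.log (contDiff_const.add (contDiff_const.mul (Real.contDiff_exp.comp (bondEval μ₀ x₀).contDiff))) fun B => ?_
  exact (add_pos_of_pos_of_nonneg one_pos (mul_nonneg hA (Real.exp_pos _).le)).ne'

/-- **(C²) OF THE SCHEMA AT THE TOWER**: every term's chart is twice continuously differentiable at `0` (indeed smooth), at EVERY volume. -/
theorem contDiffAt_expChart_term {a : (k : ℕ) → ℕ → (Fin (k + 1) → ℝ) → ℝ} (ha : ∀ k i g, 0 ≤ a k i g) (K k : ℕ) (hist : Fin (k + 1) → ℝ) (X : (domSys (F.P K) M (k + 1)).Dom) :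
    ContDiffAt ℝ 2 (expChart (F := ℝ) (fun U : Fin (F.P K).d → Site (F.P K) (k + 1) → ℝ =>
      (((nestedTower F M a K) k).E hist (originReading F K k U) X).re) (ContinuousLinearMap.id ℝ ℝ)) 0 := by
  by_cases h : ∃ j ≤ min K (domCount (F.P K) M (k + 1) - 1), X = segDom (domCount (F.P K) M (k + 1)) (Fin.cast (F.P_d K).symm 0) j
  · obtain ⟨j, hj, rfl⟩ := h
    rw [expChart_term_segDom F M ha K k hist hj]
    have hA : ∀ j', 0 ≤ ∑ i ∈ Finset.range j', a k i hist := fun j' => Finset.sum_nonneg fun i _ => ha k i hist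
    exact ((contDiff_log_one_add_mul_exp_bondEval (hA _) _ _).sub (contDiff_log_one_add_mul_exp_bondEval (hA _) _ _)).contDiffAt
  · push Not at h
    rw [expChart_term_other F M a K k hist fun i hi hXi => h i hi hXi]
    exact contDiffAt_const

/-- **THE SUM OF ALL TERM CHARTS OF THE `K`-TH TORUS TELESCOPES** to `log(1 + e^{t}·Σ_{i ≤ m} a i)`, `m = min K (n − 1)` the tower's cap, `t = B(e₀, 0)` (the polymer terms telescope,
every other domain contributes `0`). -/
theorem sum_univ_expChart_term {a : (k : ℕ) → ℕ → (Fin (k + 1) → ℝ) → ℝ} (ha : ∀ k i g, 0 ≤ a k i g) (K k : ℕ) (hist : Fin (k + 1) → ℝ) (B : Fin (F.P K).d → Site (F.P K) (k + 1) → ℝ) :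
    ∑ X : (domSys (F.P K) M (k + 1)).Dom, expChart (F := ℝ) (fun U : Fin (F.P K).d → Site (F.P K) (k + 1) → ℝ =>
        (((nestedTower F M a K) k).E hist (originReading F K k U) X).re) (ContinuousLinearMap.id ℝ ℝ) B =
      Real.log (1 + (∑ i ∈ Finset.range (min K (domCount (F.P K) M (k + 1) - 1) + 1), a k i hist) *
        Real.exp (bondEval (Fin.cast (F.P_d K).symm 0) (siteOfInt F K (k + 1) 0) B)) := by
  classical
  set n := domCount (F.P K) M (k + 1) with hn
  set m := min K (n - 1) with hm
  have hcap : m + 1 ≤ n := cap_spec K n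
  set c : (domSys (F.P K) M (k + 1)).Dom → ℝ := fun X => expChart (F := ℝ) (fun U : Fin (F.P K).d → Site (F.P K) (k + 1) → ℝ =>
        (((nestedTower F M a K) k).E hist (originReading F K k U) X).re) (ContinuousLinearMap.id ℝ ℝ) B with hc
  have h1 : ∑ X ∈ (Finset.range (m + 1)).image (segDom n (Fin.cast (F.P_d K).symm 0)), c X = ∑ X : (domSys (F.P K) M (k + 1)).Dom, c X :=
    Finset.sum_subset (Finset.subset_univ _) fun X _ hX => by
      rw [hc]
      exact congrFun (expChart_term_other F M a K k hist fun i hi hXi => hX (Finset.mem_image.2 ⟨i, Finset.mem_range.2 (by omega), hXi.symm⟩)) B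
  rw [← h1, Finset.sum_image fun _ hi _ hi' h => segDom_injOn _ hcap (le_of_mem_range_of_le hi le_rfl) (le_of_mem_range_of_le hi' le_rfl) h]
  have h2 : ∀ j ∈ Finset.range (m + 1), c (segDom n (Fin.cast (F.P_d K).symm 0) j) =
      Real.log (1 + (∑ i ∈ Finset.range (j + 1), a k i hist) * Real.exp (bondEval (Fin.cast (F.P_d K).symm 0) (siteOfInt F K (k + 1) 0) B)) -
        Real.log (1 + (∑ i ∈ Finset.range j, a k i hist) * Real.exp (bondEval (Fin.cast (F.P_d K).symm 0) (siteOfInt F K (k + 1) 0) B)) := fun j hj => by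
    rw [hc]
    exact congrFun (expChart_term_segDom F M ha K k hist (le_of_mem_range_of_le hj le_rfl)) B
  rw [Finset.sum_congr rfl h2,
    Finset.sum_range_sub (fun j => Real.log (1 + (∑ i ∈ Finset.range j, a k i hist) * Real.exp (bondEval (Fin.cast (F.P_d K).symm 0) (siteOfInt F K (k + 1) 0) B)))]
  simp

open Classical in
/-- **… AND WITHOUT THE TOP POLYMER** it telescopes to `log(1 + e^{t}·Σ_{i < m} a i)`. -/
theorem sum_univ_ne_top_expChart_term {a : (k : ℕ) → ℕ → (Fin (k + 1) → ℝ) → ℝ} (ha : ∀ k i g, 0 ≤ a k i g) (K k : ℕ) (hist : Fin (k + 1) → ℝ) (B : Fin (F.P K).d → Site (F.P K) (k + 1) → ℝ) :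
    ∑ X ∈ (Finset.univ : Finset (domSys (F.P K) M (k + 1)).Dom).filter
        (fun X => X.1 ≠ segCubes (domCount (F.P K) M (k + 1)) (Fin.cast (F.P_d K).symm 0) (min K (domCount (F.P K) M (k + 1) - 1))),
      expChart (F := ℝ) (fun U : Fin (F.P K).d → Site (F.P K) (k + 1) → ℝ =>
        (((nestedTower F M a K) k).E hist (originReading F K k U) X).re) (ContinuousLinearMap.id ℝ ℝ) B =
      Real.log (1 + (∑ i ∈ Finset.range (min K (domCount (F.P K) M (k + 1) - 1)), a k i hist) *
        Real.exp (bondEval (Fin.cast (F.P_d K).symm 0) (siteOfInt F K (k + 1) 0) B)) := by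
  classical
  set n := domCount (F.P K) M (k + 1) with hn
  set m := min K (n - 1) with hm
  have hcap : m + 1 ≤ n := cap_spec K n
  set c : (domSys (F.P K) M (k + 1)).Dom → ℝ := fun X => expChart (F := ℝ) (fun U : Fin (F.P K).d → Site (F.P K) (k + 1) → ℝ =>
        (((nestedTower F M a K) k).E hist (originReading F K k U) X).re) (ContinuousLinearMap.id ℝ ℝ) B with hc
  have hsub : (Finset.range m).image (segDom n (Fin.cast (F.P_d K).symm 0)) ⊆
      (Finset.univ : Finset (domSys (F.P K) M (k + 1)).Dom).filter (fun X => X.1 ≠ segCubes n (Fin.cast (F.P_d K).symm 0) m) := by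
    intro X hX
    obtain ⟨i, hi, rfl⟩ := Finset.mem_image.1 hX
    rw [Finset.mem_filter]
    refine ⟨Finset.mem_univ _, fun h => ?_⟩
    have := segCubes_injOn _ hcap (le_of_mem_range_of_le hi (Nat.le_succ _)) (le_refl m) h
    have := Finset.mem_range.1 hi
    omega
  have h1 : ∑ X ∈ (Finset.range m).image (segDom n (Fin.cast (F.P_d K).symm 0)), c X =
      ∑ X ∈ (Finset.univ : Finset (domSys (F.P K) M (k + 1)).Dom).filter (fun X => X.1 ≠ segCubes n (Fin.cast (F.P_d K).symm 0) m), c X :=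
    Finset.sum_subset hsub fun X hX hX' => by
      have hX2 := (Finset.mem_filter.1 hX).2
      rw [hc]
      refine congrFun (expChart_term_other F M a K k hist fun i hi hXi => ?_) B
      rcases Nat.lt_or_ge i m with him | him
      · exact hX' (Finset.mem_image.2 ⟨i, Finset.mem_range.2 him, hXi.symm⟩)
      · exact hX2 (by rw [hXi, show i = m by omega]; rfl)
  rw [← h1, Finset.sum_image fun _ hi _ hi' h => segDom_injOn _ hcap (le_of_mem_range_of_le hi (Nat.le_succ _)) (le_of_mem_range_of_le hi' (Nat.le_succ _)) h]
  have h2 : ∀ j ∈ Finset.range m, c (segDom n (Fin.cast (F.P_d K).symm 0) j) =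
      Real.log (1 + (∑ i ∈ Finset.range (j + 1), a k i hist) * Real.exp (bondEval (Fin.cast (F.P_d K).symm 0) (siteOfInt F K (k + 1) 0) B)) -
        Real.log (1 + (∑ i ∈ Finset.range j, a k i hist) * Real.exp (bondEval (Fin.cast (F.P_d K).symm 0) (siteOfInt F K (k + 1) 0) B)) := fun j hj => by
    rw [hc]
    exact congrFun (expChart_term_segDom F M ha K k hist (le_of_mem_range_of_le hj (Nat.le_succ _))) B
  rw [Finset.sum_congr rfl h2,
    Finset.sum_range_sub (fun j => Real.log (1 + (∑ i ∈ Finset.range j, a k i hist) * Real.exp (bondEval (Fin.cast (F.P_d K).symm 0) (siteOfInt F K (k + 1) 0) B)))]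
  simp

/-- **THE WINDOW KERNEL OF A SUM OF TERMS WHOSE CHARTS SUM TO `log(1 + A e^t)`** is `[μ = ν = 0 ∧ window z = window 0] · A∕(1+A)²` (additivity of def-B's scalar kernel over
(C²) terms + the on-site Hessian of the logarithmic functional). -/
theorem sum_polScalar_term_eq {a : (k : ℕ) → ℕ → (Fin (k + 1) → ℝ) → ℝ} (ha : ∀ k i g, 0 ≤ a k i g) (K k : ℕ) (hist : Fin (k + 1) → ℝ) (s : Finset (domSys (F.P K) M (k + 1)).Dom) {A : ℝ} (hA : 0 ≤ A)
    (hs : ∀ B : Fin (F.P K).d → Site (F.P K) (k + 1) → ℝ, ∑ X ∈ s, expChart (F := ℝ) (fun U : Fin (F.P K).d → Site (F.P K) (k + 1) → ℝ =>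
        (((nestedTower F M a K) k).E hist (originReading F K k U) X).re) (ContinuousLinearMap.id ℝ ℝ) B =
      Real.log (1 + A * Real.exp (bondEval (Fin.cast (F.P_d K).symm 0) (siteOfInt F K (k + 1) 0) B)))
    (μ ν : Fin 4) (z : Fin 4 → ℤ) :
    ∑ X ∈ s, polScalar (fun U : Fin (F.P K).d → Site (F.P K) (k + 1) → ℝ => (((nestedTower F M a K) k).E hist (originReading F K k U) X).re)
        (ContinuousLinearMap.id ℝ ℝ) (Module.Basis.singleton Unit ℝ) (Fin.cast (F.P_d K).symm μ) (siteOfInt F K (k + 1) z) (Fin.cast (F.P_d K).symm ν)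
        (siteOfInt F K (k + 1) 0) =
      if μ = 0 ∧ ν = 0 ∧ siteOfInt F K (k + 1) z = siteOfInt F K (k + 1) 0 then A / (1 + A) ^ 2 else 0 := by
  rw [← YMDAG.N22.WindowOfLocalTerms.polScalar_finset_sum _ _ _ _ (fun X _ => contDiffAt_expChart_term F M ha K k hist X),
    polScalar_congr_expChart (ℰ' := fun U : Fin (F.P K).d → Site (F.P K) (k + 1) → ℝ =>
      Real.log (1 + A * U (Fin.cast (F.P_d K).symm 0) (siteOfInt F K (k + 1) 0))) ?_]
  · refine (polScalar_onSiteFun F K (k + 1) (f := fun u => Real.log (1 + A * u)) (hasDerivAt_log_one_add_mul_exp hA)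
      (hasDerivAt_deriv_log_one_add_mul_exp hA) μ ν z).trans ?_
    simp
  · rw [YMDAG.N22.WindowOfLocalTerms.expChart_finset_sum, expChart_onSiteFun (fun u => Real.log (1 + A * u))]
    funext B
    exact hs B

end Charts

/-! ## §2 ★★★ The hard (1.21)-existence schema fires at def-W1's `localizedSum` of the nested tower -/

section Fires

variable (F : T4Family) (M : ℕ)

/-- ★★★ **THE HARD (1.21)-EXISTENCE SCHEMA FIRES AT def-W1's `localizedSum` OF A GENUINE `ClusterTower`** — [I] p. 264 «This limit exists by the localized representation (1.7)» at the
tree's ACTUAL objects: def-W1's (1.7)∕(2.14) localized sum `localizedSum F S emb` of the nested-polymers tower `S = nestedTower F M a` read through `originReading F`, whose (2.13) terms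
are def-W1's `ClusterStep.E` = the Kotecký–Preiss resummation `B13Resummation.locE` on def-T's torus catalogue with the touching relation `TTouch`, COMPUTED (§4, §7).  For amplitudes
`a ≥ 0` with a geometric tail `a (i+1) ≤ C r^i` (`0 ≤ r < 1`): from the volume threshold on, the terms of the `K + 1` polymers of the `K`-th torus have the SAME window kernels as the
first `K + 1` of the `(K+1)`-th torus ((S) EXACT — volume-blind local terms) and the ONE new polymer there is the tail ((T), `≤ |C| r^K`), so dag-n22-w3 g2's `polLimitExists_sum_of_stable_tail`
(p597055) gives W1-19b's `PolLimitsExist F (localizedSum F (nestedTower F M a) (originReading F)) id 𝟙 W` on EVERY window `W`.  MODEL LEVEL (test activities; the window couplings are not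
read); NOT Bałaban's activities; no letter OF RECORD; (1.21) for the terms OF RECORD NOT proved. -/
theorem polLimitsExist_localizedSum_nestedTower [NeZero M] {a : (k : ℕ) → ℕ → (Fin (k + 1) → ℝ) → ℝ} (ha : ∀ k i g, 0 ≤ a k i g) {r C : ℝ} (hr : r < 1) (hr₀ : 0 ≤ r)
    (htail : ∀ k (g : Fin (k + 1) → ℝ) i, a k (i + 1) g ≤ C * r ^ i) (W : Set (ℕ → ℝ)) :
    PolLimitsExist F (localizedSum F (nestedTower F M a) (originReading F)) (ContinuousLinearMap.id ℝ ℝ) (Module.Basis.singleton Unit ℝ) W := by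
  classical
  intro g _ k
  obtain ⟨K₁, hK₁⟩ := exists_threshold_domCount (F := F) (M := M) k
  refine polLimitExists_sum_of_stable_tail F (k + 1) (ContinuousLinearMap.id ℝ ℝ) (Module.Basis.singleton Unit ℝ) (fun K => (domSys (F.P K) M (k + 1)).Dom)
    (fun _ => Finset.univ) (fun K X U => (((nestedTower F M a K) k).E (histPrefix g k) (originReading F K k U) X).re)
    (fun K X _ => contDiffAt_expChart_term F M ha K k (histPrefix g k) X) (fun _ _ => True)
    (fun K X => X.1 ≠ segCubes (domCount (F.P (K + 1)) M (k + 1)) (Fin.cast (F.P_d (K + 1)).symm 0) (min (K + 1) (domCount (F.P (K + 1)) M (k + 1) - 1)))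
    hr fun μ ν z => ?_
  obtain ⟨K₂, hK₂⟩ := exists_threshold_siteOfInt F (k + 1) z
  refine ⟨max K₁ K₂, |C|, fun K hK => ?_⟩
  have hK1 : K₁ ≤ K := (le_max_left _ _).trans hK
  have hK2 : K₂ ≤ K := (le_max_right _ _).trans hK
  have hmK : min K (domCount (F.P K) M (k + 1) - 1) = K := by have := hK₁ K hK1; omega
  have hmK' : min (K + 1) (domCount (F.P (K + 1)) M (k + 1) - 1) = K + 1 := by have := hK₁ (K + 1) (by omega); omega
  have hA : ∀ j, 0 ≤ ∑ i ∈ Finset.range j, a k i (histPrefix g k) := fun j => Finset.sum_nonneg fun i _ => ha k i _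
  obtain ⟨hw, hw'⟩ := hK₂ K hK2
  refine ⟨?_, ?_, ?_⟩
  · -- (S): both partial sums have the kernel `[br]·ψ(Σ_{i ≤ K} a i)`
    rw [Finset.filter_true, sum_polScalar_term_eq F M ha K k _ Finset.univ (hA (K + 1)) (fun B => by rw [sum_univ_expChart_term F M ha K k, hmK]) μ ν z,
      sum_polScalar_term_eq F M ha (K + 1) k _ _ (hA (K + 1)) (fun B => by rw [sum_univ_ne_top_expChart_term F M ha (K + 1) k, hmK']) μ ν z]
    exact if_congr (and_congr Iff.rfl (and_congr Iff.rfl (hw.trans hw'.symm))) rfl rfl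
  · -- (T) in volume `K`: no volume-feeling term
    simp only [not_true_eq_false, Finset.filter_false, Finset.sum_empty]
    positivity
  · -- (T) in volume `K + 1`: the single top polymer `seg (K+1)`, kernel `ψ(A_{K+2}) − ψ(A_{K+1})`
    rw [hmK']
    set top : (domSys (F.P (K + 1)) M (k + 1)).Dom := segDom (domCount (F.P (K + 1)) M (k + 1)) (Fin.cast (F.P_d (K + 1)).symm 0) (K + 1) with htop
    have hsingle : (Finset.univ : Finset (domSys (F.P (K + 1)) M (k + 1)).Dom).filter
        (fun X => ¬ X.1 ≠ segCubes (domCount (F.P (K + 1)) M (k + 1)) (Fin.cast (F.P_d (K + 1)).symm 0) (K + 1)) = {top} := by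
      ext X
      refine ⟨fun h => Finset.mem_singleton.2 (Subtype.ext (not_not.1 (Finset.mem_filter.1 h).2)), fun h => Finset.mem_filter.2 ⟨Finset.mem_univ _, ?_⟩⟩
      rw [Finset.mem_singleton.1 h]
      exact not_not.2 rfl
    simp only [hsingle, Finset.sum_singleton]
    rw [
      polScalar_congr_expChart (ℰ' := fun U : Fin (F.P (K + 1)).d → Site (F.P (K + 1)) (k + 1) → ℝ =>
        Real.log (1 + (∑ i ∈ Finset.range (K + 1 + 1), a k i (histPrefix g k)) * U (Fin.cast (F.P_d (K + 1)).symm 0) (siteOfInt F (K + 1) (k + 1) 0)) -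
        Real.log (1 + (∑ i ∈ Finset.range (K + 1), a k i (histPrefix g k)) * U (Fin.cast (F.P_d (K + 1)).symm 0) (siteOfInt F (K + 1) (k + 1) 0)))
        (by
          rw [expChart_term_segDom F M ha (K + 1) k _ (by rw [hmK'])]
          exact (expChart_onSiteFun (fun u => Real.log (1 + (∑ i ∈ Finset.range (K + 1 + 1), a k i (histPrefix g k)) * u) -
            Real.log (1 + (∑ i ∈ Finset.range (K + 1), a k i (histPrefix g k)) * u)) _ _).symm),
      polScalar_onSiteFun F (K + 1) (k + 1) (f := fun u => Real.log (1 + (∑ i ∈ Finset.range (K + 1 + 1), a k i (histPrefix g k)) * u) - Real.log (1 + (∑ i ∈ Finset.range (K + 1), a k i (histPrefix g k)) * u))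
        (h'' := fun t => (∑ i ∈ Finset.range (K + 1 + 1), a k i (histPrefix g k)) * Real.exp t / (1 + (∑ i ∈ Finset.range (K + 1 + 1), a k i (histPrefix g k)) * Real.exp t) ^ 2 -
          (∑ i ∈ Finset.range (K + 1), a k i (histPrefix g k)) * Real.exp t / (1 + (∑ i ∈ Finset.range (K + 1), a k i (histPrefix g k)) * Real.exp t) ^ 2)
        (fun t => (hasDerivAt_log_one_add_mul_exp (hA _) t).sub (hasDerivAt_log_one_add_mul_exp (hA _) t))
        (fun t => (hasDerivAt_deriv_log_one_add_mul_exp (hA _) t).sub (hasDerivAt_deriv_log_one_add_mul_exp (hA _) t))]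
    split_ifs
    · simp only [Real.exp_zero, mul_one]
      refine (abs_psi_sub_psi_le (hA _) (hA _)).trans ?_
      rw [Finset.sum_range_succ, add_sub_cancel_left, abs_of_nonneg (ha _ _ _)]
      exact (htail k _ K).trans (mul_le_mul_of_nonneg_right (le_abs_self C) (pow_nonneg hr₀ K))
    · rw [abs_zero]; positivity

end Fires

/-! ## §3 Non-degeneracy -/

section NonDegenerate

variable (F : T4Family) (M : ℕ)

/-- ★ **THE WINDOWED KERNEL OF def-W1's LOCALIZED SUM OF THE NESTED TOWER, IN CLOSED FORM** at every volume: `[μ = ν = 0 ∧ window z = window 0] · ψ(Σ_{i ≤ m} a i)`, `ψ(A) = A∕(1+A)²`,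
`m = min K (n − 1)` the cap (= `K` from the volume threshold on). -/
theorem polWindow_localizedSum_nestedTower {a : (k : ℕ) → ℕ → (Fin (k + 1) → ℝ) → ℝ} (ha : ∀ k i g, 0 ≤ a k i g) (K k : ℕ) (hist : Fin (k + 1) → ℝ) (μ ν : Fin 4) (z : Fin 4 → ℤ) :
    polWindow F K (k + 1) (localizedSum F (nestedTower F M a) (originReading F) k hist K) (ContinuousLinearMap.id ℝ ℝ) (Module.Basis.singleton Unit ℝ) μ ν z =
      if μ = 0 ∧ ν = 0 ∧ siteOfInt F K (k + 1) z = siteOfInt F K (k + 1) 0 then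
        (∑ i ∈ Finset.range (min K (domCount (F.P K) M (k + 1) - 1) + 1), a k i hist) /
          (1 + ∑ i ∈ Finset.range (min K (domCount (F.P K) M (k + 1) - 1) + 1), a k i hist) ^ 2 else 0 := by
  have hA : 0 ≤ ∑ i ∈ Finset.range (min K (domCount (F.P K) M (k + 1) - 1) + 1), a k i hist := Finset.sum_nonneg fun i _ => ha k i hist
  have e : localizedSum F (nestedTower F M a) (originReading F) k hist K = fun U => ∑ X ∈ (Finset.univ : Finset (domSys (F.P K) M (k + 1)).Dom),
      (((nestedTower F M a K) k).E hist (originReading F K k U) X).re := rfl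
  unfold polWindow
  rw [e, YMDAG.N22.WindowOfLocalTerms.polScalar_finset_sum _ _ _ _ (fun X _ => contDiffAt_expChart_term F M ha K k hist X)]
  exact sum_polScalar_term_eq F M ha K k hist Finset.univ hA (fun B => sum_univ_expChart_term F M ha K k hist B) μ ν z

/-- ★★ **NOT EVENTUALLY CONSTANT — THE VOLUME INCREMENTS OF THE WINDOW KERNELS ARE STRICTLY POSITIVE FROM THE THRESHOLD ON** (amplitudes `a > 0` with total mass `≤ 1`, so the
kernels `ψ(Σ_{i ≤ K} a i)` strictly increase with the volume): the (S) + (T) ⇒ Cauchy mechanism is exercised with NON-ZERO increments at def-W1's actual objects, in contrast with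
every model of the tree whose windowed kernels stabilise (`GeometricIncrements` with `C := 0`). -/
theorem polWindow_localizedSum_nestedTower_lt_succ [NeZero M] {a : (k : ℕ) → ℕ → (Fin (k + 1) → ℝ) → ℝ} (ha : ∀ k i g, 0 < a k i g) (hsum : ∀ k g j, ∑ i ∈ Finset.range j, a k i g ≤ 1) (k : ℕ) :
    ∃ K₁ : ℕ, ∀ K, K₁ ≤ K → ∀ hist : Fin (k + 1) → ℝ,
      polWindow F K (k + 1) (localizedSum F (nestedTower F M a) (originReading F) k hist K) (ContinuousLinearMap.id ℝ ℝ) (Module.Basis.singleton Unit ℝ) 0 0 0 <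
        polWindow F (K + 1) (k + 1) (localizedSum F (nestedTower F M a) (originReading F) k hist (K + 1)) (ContinuousLinearMap.id ℝ ℝ)
          (Module.Basis.singleton Unit ℝ) 0 0 0 := by
  obtain ⟨K₁, hK₁⟩ := exists_threshold_domCount (F := F) (M := M) k
  refine ⟨K₁, fun K hK hist => ?_⟩
  have hmK : min K (domCount (F.P K) M (k + 1) - 1) = K := by have := hK₁ K hK; omega
  have hmK' : min (K + 1) (domCount (F.P (K + 1)) M (k + 1) - 1) = K + 1 := by have := hK₁ (K + 1) (by omega); omega
  rw [polWindow_localizedSum_nestedTower F M (fun k i g => (ha k i g).le), polWindow_localizedSum_nestedTower F M (fun k i g => (ha k i g).le), hmK, hmK']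
  simp only [true_and, if_true]
  refine psi_lt_psi (Finset.sum_nonneg fun i _ => (ha k i hist).le) ?_ (hsum k hist _)
  rw [Finset.sum_range_succ _ (K + 1)]
  exact lt_add_of_pos_right _ (ha k _ hist)

/-- **… HENCE THE WINDOW KERNELS OF THE LOCALIZED SUM ARE NOT EVENTUALLY CONSTANT IN THE VOLUME** (the hypothesis shape of dag-n22-w3 g2's `polLimitExists_of_eventually_const` FAILS):
the (1.21) limit of W1-19b's letter just certified is attained at NO finite volume. -/
theorem not_eventuallyConst_polWindow_localizedSum_nestedTower [NeZero M] {a : (k : ℕ) → ℕ → (Fin (k + 1) → ℝ) → ℝ} (ha : ∀ k i g, 0 < a k i g) (hsum : ∀ k g j, ∑ i ∈ Finset.range j, a k i g ≤ 1) (k : ℕ)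
    (hist : Fin (k + 1) → ℝ) :
    ¬ ∃ (K₀ : ℕ) (P : ℝ), ∀ K : ℕ, K₀ ≤ K →
      polWindow F K (k + 1) (localizedSum F (nestedTower F M a) (originReading F) k hist K) (ContinuousLinearMap.id ℝ ℝ) (Module.Basis.singleton Unit ℝ) 0 0 0 = P := by
  rintro ⟨K₀, P, hP⟩
  obtain ⟨K₁, hK₁⟩ := polWindow_localizedSum_nestedTower_lt_succ F M ha hsum k
  have h := hK₁ (max K₀ K₁) (le_max_right _ _) hist
  rw [hP _ (le_max_left _ _), hP _ ((le_max_left _ _).trans (Nat.le_succ _))] at h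
  exact lt_irrefl P h

/-- ★ **THE TOWER IS GENUINE: ITS (2.13) TERMS AT THE UNIT CONFIGURATION ARE NON-ZERO ON `K + 1` DISTINCT DOMAINS OF THE `K`-TH TORUS** (`j ≤ min K (n−1)`, `a ≥ 0`, `a j > 0`):
`E^{(k+1)}(seg j; hist; (1, 0)) = log((1 + Σ_{i ≤ j} a i)∕(1 + Σ_{i < j} a i)) > 0` — def-W1's `ClusterStep.E` of a tower whose activities READ the configuration, not the termless tower. -/
theorem E_nestedTower_one_pos {a : (k : ℕ) → ℕ → (Fin (k + 1) → ℝ) → ℝ} (ha : ∀ k i g, 0 ≤ a k i g) (K k : ℕ) (hist : Fin (k + 1) → ℝ) {j : ℕ} (hj : j ≤ min K (domCount (F.P K) M (k + 1) - 1))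
    (haj : 0 < a k j hist) :
    ((nestedTower F M a K) k).E hist (originReading F K k 1) (segDom (domCount (F.P K) M (k + 1)) (Fin.cast (F.P_d K).symm 0) j) =
        ((Real.log (1 + ∑ i ∈ Finset.range (j + 1), a k i hist) - Real.log (1 + ∑ i ∈ Finset.range j, a k i hist) : ℝ) : ℂ) ∧
      0 < Real.log (1 + ∑ i ∈ Finset.range (j + 1), a k i hist) - Real.log (1 + ∑ i ∈ Finset.range j, a k i hist) := by
  have hφ : (originReading F K k 1).1 ⟨default, Fin.cast (F.P_d K).symm 0⟩ = ((1 : ℝ) : ℂ) := by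
    rw [originReading_fst]; rfl
  refine ⟨?_, ?_⟩
  · unfold nestedTower
    rw [E_nestedStep_segDom_ofReal (Fin.cast (F.P_d K).symm 0) (cap_spec K _) hist (ha k · hist) one_pos hφ hj]
    simp
  · have h0 : 0 < 1 + ∑ i ∈ Finset.range j, a k i hist := add_pos_of_pos_of_nonneg one_pos (Finset.sum_nonneg fun i _ => ha k i hist)
    refine sub_pos.2 (Real.log_lt_log h0 ?_)
    rw [Finset.sum_range_succ]
    linarith

/-- **THE HYPOTHESES OF `polLimitsExist_localizedSum_nestedTower` AND OF THE NON-DEGENERACY CERTIFICATES ARE JOINTLY MET** by the geometric amplitudes `a i := (1 − q) q^i ∕ 2`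
(`0 < q < 1`): `a > 0`, `a (i+1) ≤ 1 · q^i`, and every partial sum is `≤ 1`. -/
theorem geometricAmplitudes_admissible {q : ℝ} (hq0 : 0 < q) (hq1 : q < 1) :
    (∀ i, 0 < (1 - q) * q ^ i / 2) ∧ (∀ i, (1 - q) * q ^ (i + 1) / 2 ≤ 1 * q ^ i) ∧ (∀ j, ∑ i ∈ Finset.range j, (1 - q) * q ^ i / 2 ≤ 1) := by
  refine ⟨fun i => by have := pow_pos hq0 i; nlinarith, fun i => ?_, fun j => ?_⟩
  · rw [pow_succ, one_mul]
    have hqi := pow_pos hq0 i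
    have h1 : (1 - q) * q / 2 ≤ 1 := by nlinarith
    calc (1 - q) * (q ^ i * q) / 2 = q ^ i * ((1 - q) * q / 2) := by ring
      _ ≤ q ^ i * 1 := mul_le_mul_of_nonneg_left h1 hqi.le
      _ = q ^ i := mul_one _
  · have hq' : (1 : ℝ) - q ≠ 0 := (sub_pos.2 hq1).ne'
    have hgeom : ∑ i ∈ Finset.range j, q ^ i ≤ (1 - q)⁻¹ := sum_le_hasSum _ (fun i _ => (pow_pos hq0 i).le) (hasSum_geometric_of_lt_one hq0.le hq1)
    have e : ∑ i ∈ Finset.range j, (1 - q) * q ^ i / 2 = (1 - q) / 2 * ∑ i ∈ Finset.range j, q ^ i := by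
      rw [Finset.mul_sum]; exact Finset.sum_congr rfl fun i _ => by ring
    rw [e]
    calc (1 - q) / 2 * ∑ i ∈ Finset.range j, q ^ i ≤ (1 - q) / 2 * (1 - q)⁻¹ := mul_le_mul_of_nonneg_left hgeom (by linarith)
      _ = 1 / 2 := by field_simp [hq']
      _ ≤ 1 := by norm_num

end NonDegenerate

end YMDAG.N22.AtKernels.NestedPolymers

end
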